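import Summits.PneNP.PneNP.Theorems.ChebyshevTracialDesignGammaDirectionSecondMomentRelative
import Summits.PneNP.PneNP.Theorems.ChebyshevTracialDesignGammaDirectionLevelBudgets
import Summits.PneNP.PneNP.Theorems.ChebyshevTracialDesignGammaDirectionFirstMomentTurnkey
import Summits.PneNP.PneNP.Theorems.ChebyshevTracialDesignLqConstantsScale
import HarnessLib

/-!
# Cell pnp-psdrank, route `ChebyshevTracialDesign`: the (hA) SLOT of brick 130 at one window point, budgets PLUGGED
# (crux `TracialDecayExp20`, stmt-PneNP-19878)

Brick 141a (prover g28; MEMO-31 §3(b)). Brick 139 (`…SecondMomentRelative.sum_abs_fwdDiff_centredSecond_le_rel`) gives hypothesis (hA) of brick 130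
in relative form from budgets of Lq SHAPE for the three law families of the Leibniz split. This file PLUGS the budgets — the tree's
`ShellStep.abs_fwdDiff_iter_shellLaw_le_of_hyps` (family on `[n]`, `N₀` edges, cut `2s+1`, point `x`) and brick 136's `levelBudget_pin1`
(`N₀−1`, cut `2s−1`, point `x−2`) / `levelBudget_pin2` (`N₀−2`, cut `2s−3`, point `x−4`) — with Lq's five real margins taken ONCE at
`(N₀−2, ε+8)` (moved by `lqMargins_mono`, windows moved by eng's `window_pin1` twice), dominates the three families' constants by ONE pair
`(Γ, q)` through six comparison hypotheses in the literal shape of eng's `lqConstants_le` (brick 140a) and the three tails by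
`e^{−(L−2D)²/(4N₀)}` (`exp_far_mono`), and returns (hA) in brick 130's own currency (`shell M.2.partner (2s+1) (2j+1)`, point `(x : ℤ)`):

* **`centredSecond_slot`**: `Σ_{k∈[1,D]} c_k|Δ^k[j ↦ A^m_{2j+1}(x)](0)| ≤ ε_A·A^m_1(x)` with `ε_A` = brick 139's expression at
  `τ = e^{−(L−2D)²/(4N₀)}` (cut written through `r`, `r + 3 = s`), for every real centring `m` with brick 130's `hcentre` at `x` (eng's
  `hcentre_condMean` supplies it for the conditional mean), the variance floor `V·law_1(x) ≤ A^m_1(x)` (lit's `centredSq_law_ge_of_window_one`,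
  `V = r_V²/2`) and the window floor `LB ≤ law_1(x)`.
Companions: eng g26's `…FirstMomentTurnkey.sum_abs_fwdDiff_centredFirst_le` ((hBm) slot) and `sum_abs_fwdDiff_shellLaw_le_of_budget` ((hC) slot);
smallness `ε_A ≤ ¾` is eng's brick 140d. WHAT THIS FILE DOES NOT DO: the numerics, (V)/LB themselves, the plug into bricks 130/134, anything on
`TracialDecayExp20` itself, psd rank of P_PM(K_n), or P vs NP. [cite: Rothvoss2017, §2 (PDF p. 6)] [cite: RollinRoss2010, §4.1 Thm 4.2]
[cite: Boole2009, Ch. II Art. 10 Ex. 3 eq. (8)]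
Stature: support/instrument (kernel lane, no defs, axioms standard; constants asymptotic only). Supports stmt-PneNP-19878.
-/

set_option linter.dupNamespace false -- `Summit.PneNP.PneNP.…`: summit = sub-problem (D-0017)

noncomputable section

namespace Summit.PneNP.PneNP.Theorems.ChebyshevTracialDesignGammaDirectionSecondMomentSlot

open Finset Polynomial Literature.Barriers.PneNP Literature.Combinatorics.Optimization
open Literature.Combinatorics.Optimization.ShellStep
open Summit.PneNP.PneNP.Theorems.ChebyshevTracialDesignShellOperatorForm (shell_partner_nonempty)
open Summit.PneNP.PneNP.Theorems.ChebyshevTracialDesignGammaDirectionSecondMomentRelative (sum_abs_fwdDiff_centredSecond_le_rel)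
open Summit.PneNP.PneNP.Theorems.ChebyshevTracialDesignGammaDirectionLevelBudgets (levelBudget_pin1 levelBudget_pin2 lqMargins_mono)
open Summit.PneNP.PneNP.Theorems.ChebyshevTracialDesignGammaDirectionFirstMomentTurnkey (window_pin1)
open Summit.PneNP.PneNP.Theorems.ChebyshevTracialDesignLqConstantsScale (exp_far_mono)

variable {n : ℕ}

/-- **Domination of an Lq-shaped budget** (`0 ≤ Γ' ≤ Γ`, `0 ≤ q' ≤ q`, `τ' ≤ τ`, `g, κ, w ≥ 0`).
[cite: RollinRoss2010, §4.1 Thm 4.2] -/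
theorem lqShape_dominate {c Γ' Γ q' q g κ κ' w τ' τ : ℝ} {k : ℕ} (hc : c ≤ Γ' * q' ^ k * g + κ' * (w * τ'))
    (hΓ0 : 0 ≤ Γ') (hΓ : Γ' ≤ Γ) (hq0 : 0 ≤ q') (hq : q' ≤ q) (hg : 0 ≤ g) (hκ0 : 0 ≤ κ') (hκ : κ' ≤ κ) (hw : 0 ≤ w)
    (hτ0 : 0 ≤ τ') (hτ : τ' ≤ τ) :
    c ≤ Γ * q ^ k * g + κ * (w * τ) := by
  have h1 : q' ^ k ≤ q ^ k := pow_le_pow_left₀ hq0 hq k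
  have h2 : Γ' * q' ^ k * g ≤ Γ * q ^ k * g :=
    mul_le_mul_of_nonneg_right (mul_le_mul hΓ h1 (pow_nonneg hq0 k) (hΓ0.trans hΓ)) hg
  have h3 : κ' * (w * τ') ≤ κ * (w * τ) :=
    mul_le_mul hκ (mul_le_mul_of_nonneg_left hτ hw) (mul_nonneg hw hτ0) (hκ0.trans hκ)
  linarith only [hc, h2, h3]

set_option maxHeartbeats 400000 in -- measured: passes at 200 000, fails at 160 000 (three Lq/brick-136 instantiations + brick 139 in one context)
/-- **THE (hA) SLOT OF BRICK 130 AT ONE WINDOW POINT, BUDGETS PLUGGED (brick 141a).** See the module docstring. Integer data: `N₂+1 = N₁`, `N₁+1 = N₀`,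
`s₂+1 = s₁`, `s₁+1 = s`, `r+3 = s`, `x₂+2 = x₁`, `x₁+2 = x`, `a₂+2 = a`; Lq's margins once at `(N₂, ε+8)`; brick 139's `k = 1` leg with its own window
half-width `Lx` and constants `E`, `Far`; the six comparisons `Γ(N_i) ≤ Γ`, `q(N_i) ≤ q ≤ 1` in the literal shape of `lqConstants_le`.
[cite: Rothvoss2017, §2 (PDF p. 6)] [cite: RollinRoss2010, §3 (Lemma 3.3), §4.1 Thm 4.2] [cite: Boole2009, Ch. II Art. 10 Ex. 3 eq. (8)] -/
theorem centredSecond_slot (M : PMatch n) (H : Finset (Fin n)) {a a₂ b d N₀ N₁ N₂ s s₁ s₂ r D x x₁ x₂ : ℕ}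
    (hN01 : N₁ + 1 = N₀) (hN12 : N₂ + 1 = N₁) (hs₁ : s₁ + 1 = s) (hs₂ : s₂ + 1 = s₁) (hr : r + 3 = s)
    (hx₁ : x₁ + 2 = x) (hx₂ : x₂ + 2 = x₁) (haa : a₂ + 2 = a)
    (ha : (reps M.2.partner (vAA M.2.partner univ H)).card = a)
    (hb : (reps M.2.partner (vBH M.2.partner univ H ∪ vBN M.2.partner univ H)).card = b)
    (hd : (reps M.2.partner (vDD M.2.partner univ H)).card = d) (hN : a + b + d = N₀) (hn : n = 2 * N₀)
    {β : ℝ} (hβ : 0 < β) (hβ1 : β ≤ 1 / 4) (hD1 : 1 ≤ D) (hDN : 16 * D + 16 ≤ N₂)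
    (hbβ : β * N₀ + 2 * D + 1 ≤ b) (hdβ : β * N₀ + 2 * D + 1 ≤ d)
    (hs : β * N₂ + D ≤ s₂) (hs' : 8 * (s : ℝ) ≤ (4 + β) * ((N₀ : ℝ) - 2 * D)) (hDs : D ≤ s₂) (hsn : 2 * s + 2 * D + 2 ≤ n)
    {ε : ℝ} (hxε : |(x : ℝ) - (2 * (s : ℝ) + 1) * H.card / n| < ε) (hxD : 2 * D ≤ x₂)
    {L : ℝ} (h2D : 2 * (D : ℝ) ≤ L) (hLN : 2 * L ≤ N₂)
    (h1 : L + D + (ε + 8 + 14 * D + 1) ≤ β ^ 2 * N₂)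
    (h2 : L + D + (ε + 8 + 14 * D + 1) + 3 ≤ β * ((N₂ : ℝ) - 2 * D) / 8)
    (h3 : 2 * (L + D + 1) ≤ (β ^ 2 / 8) ^ 2 * (β * ((N₂ : ℝ) - 2 * D)))
    (h4 : 4 ≤ β * ((N₂ : ℝ) - 2 * D))
    (h5 : (D : ℝ) * (1 + 8 * (L + D + 1) / ((β ^ 2 / 8) ^ 4 * (β * ((N₂ : ℝ) - 2 * D)))) ≤
      (β ^ 2 / 8) ^ 4 * (β * ((N₂ : ℝ) - 2 * D)))
    {Lx : ℝ} (h2Lx : 2 ≤ Lx) (hLxN : Lx - 2 ≤ 2 * ((N₀ : ℝ) - 2))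
    (hLx1 : Lx + 1 + (ε + 15) ≤ β * ((r : ℝ) + 2)) (hLx2 : Lx + 1 + (ε + 15) + 3 ≤ β * ((N₀ : ℝ) - 2) / 8)
    (hwin : 2 * (Lx + 1 + 1) ≤ (β ^ 2 / 8) ^ 2 * (β * ((N₀ : ℝ) - 2))) (hN4 : 4 ≤ β * ((N₀ : ℝ) - 2))
    (hkV : (1 : ℝ) * (1 + 8 * (Lx + 1 + 1) / ((β ^ 2 / 8) ^ 4 * (β * ((N₀ : ℝ) - 2)))) ≤
      (β ^ 2 / 8) ^ 4 * (β * ((N₀ : ℝ) - 2)))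
    {E Far : ℝ} (hE0 : 0 ≤ E) (hFar0 : 0 ≤ Far)
    (hE : (((1 + 8 * (Lx + 1 + 1) / ((β ^ 2 / 8) ^ 4 * (β * ((N₀ : ℝ) - 2)))) *
            (8 * (Lx + 1 + 1) / ((β ^ 2 / 8) ^ 4 * (β * ((N₀ : ℝ) - 2))) +
              2 * Real.sqrt 192 * Real.sqrt (2 * (2 * (1 : ℝ) + 1) *
                (1 + 8 * (Lx + 1 + 1) / ((β ^ 2 / 8) ^ 4 * (β * ((N₀ : ℝ) - 2)))) /
                  ((β ^ 2 / 8) ^ 4 * (β * ((N₀ : ℝ) - 2)))))) ^ (2 * 1) *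
          (1 + 4 * (Real.sqrt ((N₀ : ℝ) - 2) + 1) / 3 *
            (2 * Real.sqrt 192 * Real.sqrt (2 * (2 * (1 : ℝ) + 1) *
              (1 + 8 * (Lx + 1 + 1) / ((β ^ 2 / 8) ^ 4 * (β * ((N₀ : ℝ) - 2)))) /
                ((β ^ 2 / 8) ^ 4 * (β * ((N₀ : ℝ) - 2))))))) ≤ E)
    (hFar : (4 : ℝ) ^ 1 * Real.exp (-((Lx - 2 * 1) ^ 2 / (4 * ((N₀ : ℝ) - 2)))) ≤ Far)
    {Γ q : ℝ}
    (hΓ₀ : (1 + 4 * (Real.sqrt N₀ + 1) / 3 *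
          (2 * Real.sqrt 192 * Real.sqrt (2 * (2 * (D : ℝ) + 1) * (1 + 8 * (L + D + 1) / ((β ^ 2 / 8) ^ 4 * (β * ((N₀ : ℝ) - 2 * D)))) /
            ((β ^ 2 / 8) ^ 4 * (β * ((N₀ : ℝ) - 2 * D)))))) ≤ Γ)
    (hΓ₁ : (1 + 4 * (Real.sqrt N₁ + 1) / 3 *
          (2 * Real.sqrt 192 * Real.sqrt (2 * (2 * (D : ℝ) + 1) * (1 + 8 * (L + D + 1) / ((β ^ 2 / 8) ^ 4 * (β * ((N₁ : ℝ) - 2 * D)))) /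
            ((β ^ 2 / 8) ^ 4 * (β * ((N₁ : ℝ) - 2 * D)))))) ≤ Γ)
    (hΓ₂ : (1 + 4 * (Real.sqrt N₂ + 1) / 3 *
          (2 * Real.sqrt 192 * Real.sqrt (2 * (2 * (D : ℝ) + 1) * (1 + 8 * (L + D + 1) / ((β ^ 2 / 8) ^ 4 * (β * ((N₂ : ℝ) - 2 * D)))) /
            ((β ^ 2 / 8) ^ 4 * (β * ((N₂ : ℝ) - 2 * D)))))) ≤ Γ)
    (hq₀ : (4 * ((1 + 8 * (L + D + 1) / ((β ^ 2 / 8) ^ 4 * (β * ((N₀ : ℝ) - 2 * D)))) *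
          (8 * (L + D + 1) / ((β ^ 2 / 8) ^ 4 * (β * ((N₀ : ℝ) - 2 * D))) +
            2 * Real.sqrt 192 * Real.sqrt (2 * (2 * (D : ℝ) + 1) * (1 + 8 * (L + D + 1) / ((β ^ 2 / 8) ^ 4 * (β * ((N₀ : ℝ) - 2 * D)))) /
            ((β ^ 2 / 8) ^ 4 * (β * ((N₀ : ℝ) - 2 * D)))))) ^ 2 / (3 * β)) ≤ q)
    (hq₁ : (4 * ((1 + 8 * (L + D + 1) / ((β ^ 2 / 8) ^ 4 * (β * ((N₁ : ℝ) - 2 * D)))) *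
          (8 * (L + D + 1) / ((β ^ 2 / 8) ^ 4 * (β * ((N₁ : ℝ) - 2 * D))) +
            2 * Real.sqrt 192 * Real.sqrt (2 * (2 * (D : ℝ) + 1) * (1 + 8 * (L + D + 1) / ((β ^ 2 / 8) ^ 4 * (β * ((N₁ : ℝ) - 2 * D)))) /
            ((β ^ 2 / 8) ^ 4 * (β * ((N₁ : ℝ) - 2 * D)))))) ^ 2 / (3 * β)) ≤ q)
    (hq₂ : (4 * ((1 + 8 * (L + D + 1) / ((β ^ 2 / 8) ^ 4 * (β * ((N₂ : ℝ) - 2 * D)))) *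
          (8 * (L + D + 1) / ((β ^ 2 / 8) ^ 4 * (β * ((N₂ : ℝ) - 2 * D))) +
            2 * Real.sqrt 192 * Real.sqrt (2 * (2 * (D : ℝ) + 1) * (1 + 8 * (L + D + 1) / ((β ^ 2 / 8) ^ 4 * (β * ((N₂ : ℝ) - 2 * D)))) /
            ((β ^ 2 / 8) ^ 4 * (β * ((N₂ : ℝ) - 2 * D)))))) ^ 2 / (3 * β)) ≤ q)
    (hq1 : q ≤ 1)
    (m : ℝ)
    (hcentre : ((∑ U ∈ ((shell M.2.partner (2 * s + 1) 1).filter fun U => ((U ∩ H).card : ℤ) = (x : ℤ)),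
          (((((reps M.2.partner (vAA M.2.partner univ H)).filter fun v => v ∈ U ∧ M.2.partner v ∈ U).card : ℕ) : ℝ) - m)) /
          ((shell M.2.partner (2 * s + 1) 1).card : ℝ)) = 0)
    {V LB : ℝ} (hV : 0 < V) (hLB : 0 < LB)
    (hVA : V * shellLaw M.2.partner univ H (2 * s + 1) 1 (x : ℤ) ≤ ((∑ U ∈ ((shell M.2.partner (2 * s + 1) 1).filter fun U => ((U ∩ H).card : ℤ) = (x : ℤ)),
          (((((reps M.2.partner (vAA M.2.partner univ H)).filter fun v => v ∈ U ∧ M.2.partner v ∈ U).card : ℕ) : ℝ) - m) ^ 2) /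
          ((shell M.2.partner (2 * s + 1) 1).card : ℝ)))
    (hLBl : LB ≤ shellLaw M.2.partner univ H (2 * s + 1) 1 (x : ℤ)) :
    ∑ k ∈ Ico 1 (D + 1), (((2 * k).choose k : ℕ) : ℝ) / (4 : ℝ) ^ k *
        |(fwdDiff (1 : ℕ))^[k] (fun j : ℕ =>
          ((∑ U ∈ ((shell M.2.partner (2 * s + 1) (2 * j + 1)).filter fun U => ((U ∩ H).card : ℤ) = (x : ℤ)),
            (((((reps M.2.partner (vAA M.2.partner univ H)).filter fun v => v ∈ U ∧ M.2.partner v ∈ U).card : ℕ) : ℝ) - m) ^ 2) /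
            ((shell M.2.partner (2 * s + 1) (2 * j + 1)).card : ℝ))) 0| ≤
      ((E * ((n : ℝ) * ((n : ℝ) - 2) / ((2 * (r : ℝ) + 6) * ((n : ℝ) - 2 * r - 8))) / 4 + 1 / ((r : ℝ) + 1)) +
          ((E * ((n : ℝ) * ((n : ℝ) - 2) / ((2 * (r : ℝ) + 6) * ((n : ℝ) - 2 * r - 8))) / 4 * (2 * (a : ℝ) ^ 2 / ((r : ℝ) + 1) + (2 * (a : ℝ) + 1) * a / ((r : ℝ) + 2)) +
            (2 * (a : ℝ) + 1) * ((r : ℝ) + 3) / (2 * ((r : ℝ) + 2) * ((r : ℝ) + 1)) *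
              ((a : ℝ) * (4 * Γ * q + (2 + 4 * Γ * q) / (2 * (r : ℝ) + 6))) +
            (a : ℝ) * (2 * (a : ℝ) + r + 3) / (2 * ((r : ℝ) + 2) * ((r : ℝ) + 1)) * (1 + 2 * Γ * q)) +
            (D : ℝ) * (2 * Γ * q ^ 2 * (a : ℝ) ^ 2 + 8 * (D : ℝ) * Γ * q * (a : ℝ) ^ 2 / (2 * (r : ℝ) + 6) +
            32 * (D : ℝ) ^ 2 * Γ * (a : ℝ) ^ 2 / ((2 * (r : ℝ) + 6) * (2 * (r : ℝ) + 4)) +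
            (2 * (a : ℝ) + 1) * a * (Γ * q ^ 2 + 4 * (D : ℝ) * Γ * q / (2 * (r : ℝ) + 6)))) / V +
          ((((2 * (a : ℝ) + 1) * ((r : ℝ) + 3) / (2 * ((r : ℝ) + 2) * ((r : ℝ) + 1)) * (16 * (a : ℝ) / 3) +
            (a : ℝ) * (2 * (a : ℝ) + r + 3) / (2 * ((r : ℝ) + 2) * ((r : ℝ) + 1)) * (8 / 3)) +
              (D : ℝ) * (4 / 3 : ℝ) ^ D *
            ((a : ℝ) ^ 2 * ((2 * (r : ℝ) + 6) * (2 * (r : ℝ) + 4) / ((n : ℝ) * ((n : ℝ) - 2)) + 8 * (D : ℝ) * (2 * (r : ℝ) + 4) / ((n : ℝ) * ((n : ℝ) - 2)) +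
                32 * (D : ℝ) ^ 2 / ((n : ℝ) * ((n : ℝ) - 2)) + 1) +
              (2 * (a : ℝ) + 1) * a * ((2 * (r : ℝ) + 6 + 4 * D) / (n : ℝ)))) * Real.exp (-((L - 2 * D) ^ 2 / (4 * N₀))) +
            ((((r : ℝ) + 2 + a) ^ 2 + 2 * ((r : ℝ) + 2) ^ 2 / ((r : ℝ) + 1) + (2 * (a : ℝ) + 1)) / 4) * Far) / (LB * V)) *
        ((∑ U ∈ ((shell M.2.partner (2 * s + 1) 1).filter fun U => ((U ∩ H).card : ℤ) = (x : ℤ)),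
          (((((reps M.2.partner (vAA M.2.partner univ H)).filter fun v => v ∈ U ∧ M.2.partner v ∈ U).card : ℕ) : ℝ) - m) ^ 2) /
          ((shell M.2.partner (2 * s + 1) 1).card : ℝ)) := by
  classical
  -- integer / real bookkeeping
  have hπ := partner_partner M
  have hπ' := partner_ne M
  have hcut0 : 2 * s + 1 = 2 * r + 1 + 6 := by omega
  have hcut1 : 2 * s₁ + 1 = 2 * r + 3 + 2 := by omega
  have hcut2 : 2 * s₂ + 1 = 2 * r + 3 := by omega
  have hN0r : (N₀ : ℝ) = N₁ + 1 := by rw [← hN01]; push_cast; ring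
  have hN1r : (N₁ : ℝ) = N₂ + 1 := by rw [← hN12]; push_cast; ring
  have hsr : (s : ℝ) = s₁ + 1 := by rw [← hs₁]; push_cast; ring
  have hs1r : (s₁ : ℝ) = s₂ + 1 := by rw [← hs₂]; push_cast; ring
  have hrr : (r : ℝ) + 3 = s := by exact_mod_cast hr
  have hD0 : (0 : ℝ) ≤ D := Nat.cast_nonneg _
  have hD1r : (1 : ℝ) ≤ D := by exact_mod_cast hD1
  have hN2_16 : (16 : ℝ) ≤ N₂ := by exact_mod_cast (show 16 ≤ N₂ by omega)
  have hN2N1 : (N₂ : ℝ) ≤ N₁ := by rw [hN1r]; linarith only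
  have hN1N0 : (N₁ : ℝ) ≤ N₀ := by rw [hN0r]; linarith only
  have hN2N0 : (N₂ : ℝ) ≤ N₀ := hN2N1.trans hN1N0
  have hN2pos : (0 : ℝ) < N₂ := by linarith only [hN2_16]
  have hN1pos : (0 : ℝ) < N₁ := by linarith only [hN2_16, hN2N1]
  have hnr : (n : ℝ) = 2 * (N₀ : ℝ) := by rw [hn]; push_cast; ring
  have hsn' : 2 * (s : ℝ) + 2 * D + 2 ≤ n := by exact_mod_cast hsn
  have hs₂0 : (0 : ℝ) ≤ s₂ := Nat.cast_nonneg _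
  have htypes := card_eq_two_mul_add_of_types hπ hπ' H
  rw [ha, hb] at htypes
  have hHcard : (H.card : ℝ) = 2 * a + b := by rw [htypes]; push_cast; ring
  have ha2 : 2 ≤ a := by omega
  have hHge4 : 4 ≤ H.card := by omega
  have habd : ((a : ℝ) + b + d) = N₀ := by exact_mod_cast hN
  have ha0 : (0 : ℝ) ≤ a := Nat.cast_nonneg _
  have hb0 : (0 : ℝ) ≤ b := Nat.cast_nonneg _
  have hd0 : (0 : ℝ) ≤ d := Nat.cast_nonneg _
  -- Lq's margins at the three edge numbers
  obtain ⟨hLN₁, h1₁, h2₁, h3₁, h4₁, h5₁⟩ := lqMargins_mono (ε := ε + 8) hβ h2D hN2N1 hLN h1 h2 h3 h4 h5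
  obtain ⟨hLN₀, h1₀, h2₀, h3₀, h4₀, h5₀⟩ := lqMargins_mono (ε := ε + 8) hβ h2D hN2N0 hLN h1 h2 h3 h4 h5
  have h1₁' : L + D + (ε + 4 + 14 * D + 1) ≤ β ^ 2 * N₁ := by linarith only [h1₁]
  have h2₁' : L + D + (ε + 4 + 14 * D + 1) + 3 ≤ β * ((N₁ : ℝ) - 2 * D) / 8 := by linarith only [h2₁]
  have h1₀' : L + D + (ε + 14 * D + 1) ≤ β ^ 2 * N₀ := by linarith only [h1₀]
  have h2₀' : L + D + (ε + 14 * D + 1) + 3 ≤ β * ((N₀ : ℝ) - 2 * D) / 8 := by linarith only [h2₀]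
  have hDN₁ : 16 * D + 16 ≤ N₁ := by omega
  have hDN₀ : 16 * D + 16 ≤ N₀ := by omega
  have hβN1 : β * N₁ ≤ β * N₀ := mul_le_mul_of_nonneg_left hN1N0 hβ.le
  have hβN2 : β * N₂ ≤ β * N₀ := mul_le_mul_of_nonneg_left hN2N0 hβ.le
  have hbβ₁ : β * N₁ + 2 * D + 1 ≤ b := by linarith only [hβN1, hbβ]
  have hdβ₁ : β * N₁ + 2 * D + 1 ≤ d := by linarith only [hβN1, hdβ]
  have hbβ₂ : β * N₂ + 2 * D + 1 ≤ b := by linarith only [hβN2, hbβ]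
  have hdβ₂ : β * N₂ + 2 * D + 1 ≤ d := by linarith only [hβN2, hdβ]
  have hs₁' : β * N₁ + D ≤ s₁ := by
    have e : β * (N₁ : ℝ) = β * N₂ + β := by rw [hN1r]; ring
    rw [e, hs1r]; linarith only [hs, hβ1]
  have hs₀ : β * N₀ + D ≤ s := by
    have e : β * (N₀ : ℝ) = β * N₂ + 2 * β := by rw [hN0r, hN1r]; ring
    rw [e, hsr, hs1r]; linarith only [hs, hβ1]
  have hs''₁ : 8 * (s₁ : ℝ) ≤ (4 + β) * ((N₁ : ℝ) - 2 * D) := by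
    have e1 : 8 * (s₁ : ℝ) = 8 * s - 8 := by rw [hsr]; ring
    have e2 : (4 + β) * ((N₁ : ℝ) - 2 * D) = (4 + β) * ((N₀ : ℝ) - 2 * D) - (4 + β) := by rw [hN0r]; ring
    rw [e1, e2]; linarith only [hs', hβ1]
  have hs''₂ : 8 * (s₂ : ℝ) ≤ (4 + β) * ((N₂ : ℝ) - 2 * D) := by
    have e1 : 8 * (s₂ : ℝ) = 8 * s - 16 := by rw [hsr, hs1r]; ring
    have e2 : (4 + β) * ((N₂ : ℝ) - 2 * D) = (4 + β) * ((N₀ : ℝ) - 2 * D) - 2 * (4 + β) := by rw [hN0r, hN1r]; ring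
    rw [e1, e2]; linarith only [hs', hβ1]
  have hne₀ : ∀ k, k ≤ D → (shellIn M.2.partner univ (2 * s + 1) (1 + 2 * k)).Nonempty := by
    intro k hk
    rw [shellIn_univ]
    exact shell_partner_nonempty M ⟨s, by ring⟩ ⟨k, by ring⟩ (by omega) (by omega)
  -- the moved windows
  have hx' : |(x : ℝ) - (2 * (s : ℝ) + 1) * (H.card : ℝ) / (2 * (N₀ : ℝ))| < ε := by rw [← hnr]; exact hxε
  have hw₁ := window_pin1 (P := (H.card : ℝ)) (by rw [hN0r]; linarith only [hN2_16, hN2N1]) (by exact_mod_cast (show 2 ≤ H.card by omega))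
    (by rw [hHcard, ← habd]; linarith only [(Nat.cast_nonneg d : (0 : ℝ) ≤ d), (Nat.cast_nonneg b : (0 : ℝ) ≤ b)])
    (by rw [hsr]; linarith only [hs1r, hs₂0]) (by rw [← hnr]; linarith only [hsn', hD0]) hx'
  have ex₁ : (x : ℝ) - 2 = x₁ := by rw [← hx₁]; push_cast; ring
  have es₁ : 2 * (s : ℝ) - 1 = 2 * s₁ + 1 := by rw [hsr]; ring
  have eN₁ : (N₀ : ℝ) - 1 = N₁ := by rw [hN0r]; ring
  rw [ex₁, es₁, eN₁] at hw₁
  -- `hw₁ : |x₁ - (2 s₁ + 1)(|H| - 2)/(2 N₁)| < ε + 4`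
  have hw₂ := window_pin1 (P := (H.card : ℝ) - 2) (by rw [hN1r]; linarith only [hN2_16]) (by
      have : (4 : ℝ) ≤ H.card := by exact_mod_cast hHge4
      linarith only [this])
    (by
      have e : (N₁ : ℝ) = N₀ - 1 := by rw [hN0r]; ring
      rw [hHcard, e, ← habd]; linarith only [hb0, hd0])
    (by rw [hs1r]; linarith only [hs₂0]) (by rw [hs1r, hN1r]; linarith only [hsn', hD0, hnr, hN0r, hN1r, hsr, hs1r]) hw₁
  have ex₂ : (x₁ : ℝ) - 2 = x₂ := by rw [← hx₂]; push_cast; ring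
  have es₂ : 2 * (s₁ : ℝ) - 1 = 2 * s₂ + 1 := by rw [hs1r]; ring
  have eN₂ : (N₁ : ℝ) - 1 = N₂ := by rw [hN1r]; ring
  rw [ex₂, es₂, eN₂] at hw₂
  have hxε₁ : |(x₁ : ℝ) - (2 * (s₁ : ℝ) + 1) * ((H.card - 2 : ℕ) : ℝ) / ((n - 2 : ℕ) : ℝ)| < ε + 4 := by
    have e : ((H.card - 2 : ℕ) : ℝ) / ((n - 2 : ℕ) : ℝ) = ((H.card : ℝ) - 2) / (2 * (N₁ : ℝ)) := by
      rw [Nat.cast_sub (by omega : 2 ≤ H.card), Nat.cast_sub (by omega : 2 ≤ n), hnr, hN0r]; push_cast; ring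
    rw [mul_div_assoc, e, ← mul_div_assoc]; exact hw₁
  have hxε₂ : |(x₂ : ℝ) - (2 * (s₂ : ℝ) + 1) * ((H.card - 4 : ℕ) : ℝ) / ((n - 4 : ℕ) : ℝ)| < ε + 8 := by
    have e : ((H.card - 4 : ℕ) : ℝ) / ((n - 4 : ℕ) : ℝ) = ((H.card : ℝ) - 2 - 2) / (2 * (N₂ : ℝ)) := by
      rw [Nat.cast_sub hHge4, Nat.cast_sub (by omega : 4 ≤ n), hnr, hN0r, hN1r]; push_cast; ring
    have e4 : ε + 4 + 4 = ε + 8 := by ring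
    rw [mul_div_assoc, e, ← mul_div_assoc, ← e4]; exact hw₂
  -- the three budgets
  have hR₀ := abs_fwdDiff_iter_shellLaw_le_of_hyps hπ hπ' H ha hb hd hN hn hβ hβ1 hDN₀ hbβ hdβ hs₀ hs' hne₀ hxε (by omega) h2D hLN₀
    h1₀' h2₀' h3₀ h4₀ h5₀
  have ha₁ : (reps M.2.partner (vAA M.2.partner univ H)).card = (a₂ + 1) + 1 := by rw [ha]; omega
  have hR₁ := levelBudget_pin1 M H ha₁ hb hd (by omega) (by omega) hβ hβ1 hDN₁ hbβ₁ hdβ₁ hs₁' hs''₁ (by omega) (by omega) hxε₁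
    (by omega) h2D hLN₁ h1₁' h2₁' h3₁ h4₁ h5₁
  have ha₂' : (reps M.2.partner (vAA M.2.partner univ H)).card = a₂ + 2 := by rw [ha]; omega
  have hR₂ := levelBudget_pin2 M H ha₂' hb hd (by omega) (by omega) hβ hβ1 hDN hbβ₂ hdβ₂ hs hs''₂ (by omega) (by omega) hxε₂
    hxD h2D hLN h1 h2 h3 h4 h5
  rw [ha] at hR₁ hR₂
  -- spell the families in brick 139's currency
  have exz₁ : ((x₁ : ℕ) : ℤ) = (x : ℤ) - 2 := by rw [← hx₁]; push_cast; ring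
  have exz₂ : ((x₂ : ℕ) : ℤ) = (x : ℤ) - 4 := by rw [← hx₁, ← hx₂]; push_cast; ring
  rw [hcut0] at hR₀
  rw [hcut1, exz₁] at hR₁
  rw [hcut2, exz₂] at hR₂
  -- nonnegativity of the family constants and the domination
  have hG1_0 : 0 ≤ ∑ v ∈ reps M.2.partner (vAA M.2.partner univ H),
      shellLaw M.2.partner (univ \ {v, M.2.partner v}) H (2 * r + 3 + 2) 1 ((x : ℤ) - 2) :=
    sum_nonneg fun _ _ => shellLaw_nonneg (π := M.2.partner) _ _ _ _ _
  have hG2_0 : 0 ≤ ∑ v ∈ reps M.2.partner (vAA M.2.partner univ H), ∑ w ∈ (reps M.2.partner (vAA M.2.partner univ H)).erase v,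
      shellLaw M.2.partner (del2 M.2.partner univ v w) H (2 * r + 3) 1 ((x : ℤ) - 4) :=
    sum_nonneg fun _ _ => sum_nonneg fun _ _ => shellLaw_nonneg (π := M.2.partner) _ _ _ _ _
  have hlaw0 : 0 ≤ shellLaw M.2.partner univ H (2 * r + 1 + 6) 1 (x : ℤ) := shellLaw_nonneg (π := M.2.partner) _ _ _ _ _
  have hΓ₀0 : 0 ≤ (1 + 4 * (Real.sqrt N₀ + 1) / 3 *
          (2 * Real.sqrt 192 * Real.sqrt (2 * (2 * (D : ℝ) + 1) * (1 + 8 * (L + D + 1) / ((β ^ 2 / 8) ^ 4 * (β * ((N₀ : ℝ) - 2 * D)))) /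
            ((β ^ 2 / 8) ^ 4 * (β * ((N₀ : ℝ) - 2 * D)))))) :=
    le_trans zero_le_one (le_add_of_nonneg_right (by positivity))
  have hΓ₁0 : 0 ≤ (1 + 4 * (Real.sqrt N₁ + 1) / 3 *
          (2 * Real.sqrt 192 * Real.sqrt (2 * (2 * (D : ℝ) + 1) * (1 + 8 * (L + D + 1) / ((β ^ 2 / 8) ^ 4 * (β * ((N₁ : ℝ) - 2 * D)))) /
            ((β ^ 2 / 8) ^ 4 * (β * ((N₁ : ℝ) - 2 * D)))))) :=
    le_trans zero_le_one (le_add_of_nonneg_right (by positivity))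
  have hΓ₂0 : 0 ≤ (1 + 4 * (Real.sqrt N₂ + 1) / 3 *
          (2 * Real.sqrt 192 * Real.sqrt (2 * (2 * (D : ℝ) + 1) * (1 + 8 * (L + D + 1) / ((β ^ 2 / 8) ^ 4 * (β * ((N₂ : ℝ) - 2 * D)))) /
            ((β ^ 2 / 8) ^ 4 * (β * ((N₂ : ℝ) - 2 * D)))))) :=
    le_trans zero_le_one (le_add_of_nonneg_right (by positivity))
  have hq₀0 : 0 ≤ (4 * ((1 + 8 * (L + D + 1) / ((β ^ 2 / 8) ^ 4 * (β * ((N₀ : ℝ) - 2 * D)))) *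
          (8 * (L + D + 1) / ((β ^ 2 / 8) ^ 4 * (β * ((N₀ : ℝ) - 2 * D))) +
            2 * Real.sqrt 192 * Real.sqrt (2 * (2 * (D : ℝ) + 1) * (1 + 8 * (L + D + 1) / ((β ^ 2 / 8) ^ 4 * (β * ((N₀ : ℝ) - 2 * D)))) /
            ((β ^ 2 / 8) ^ 4 * (β * ((N₀ : ℝ) - 2 * D)))))) ^ 2 / (3 * β)) := div_nonneg (mul_nonneg (by norm_num) (sq_nonneg _)) (by positivity)
  have hq₁0 : 0 ≤ (4 * ((1 + 8 * (L + D + 1) / ((β ^ 2 / 8) ^ 4 * (β * ((N₁ : ℝ) - 2 * D)))) *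
          (8 * (L + D + 1) / ((β ^ 2 / 8) ^ 4 * (β * ((N₁ : ℝ) - 2 * D))) +
            2 * Real.sqrt 192 * Real.sqrt (2 * (2 * (D : ℝ) + 1) * (1 + 8 * (L + D + 1) / ((β ^ 2 / 8) ^ 4 * (β * ((N₁ : ℝ) - 2 * D)))) /
            ((β ^ 2 / 8) ^ 4 * (β * ((N₁ : ℝ) - 2 * D)))))) ^ 2 / (3 * β)) := div_nonneg (mul_nonneg (by norm_num) (sq_nonneg _)) (by positivity)
  have hq₂0 : 0 ≤ (4 * ((1 + 8 * (L + D + 1) / ((β ^ 2 / 8) ^ 4 * (β * ((N₂ : ℝ) - 2 * D)))) *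
          (8 * (L + D + 1) / ((β ^ 2 / 8) ^ 4 * (β * ((N₂ : ℝ) - 2 * D))) +
            2 * Real.sqrt 192 * Real.sqrt (2 * (2 * (D : ℝ) + 1) * (1 + 8 * (L + D + 1) / ((β ^ 2 / 8) ^ 4 * (β * ((N₂ : ℝ) - 2 * D)))) /
            ((β ^ 2 / 8) ^ 4 * (β * ((N₂ : ℝ) - 2 * D)))))) ^ 2 / (3 * β)) := div_nonneg (mul_nonneg (by norm_num) (sq_nonneg _)) (by positivity)
  have hτ₁ := exp_far_mono (L := L) (D := (D : ℝ)) hN1pos hN1N0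
  have hτ₂ := exp_far_mono (L := L) (D := (D : ℝ)) hN2pos hN2N0
  have hτ0 : ∀ N : ℝ, 0 ≤ Real.exp (-((L - 2 * D) ^ 2 / (4 * N))) := fun _ => Real.exp_nonneg _
  have hκ₂ : (((a * a - a : ℕ)) : ℝ) ≤ (a : ℝ) ^ 2 := by
    have : ((a * a - a : ℕ) : ℝ) ≤ ((a * a : ℕ) : ℝ) := by exact_mod_cast Nat.sub_le _ _
    rw [Nat.cast_mul] at this; nlinarith only [this]
  have hB₀ : ∀ k ∈ Ico 1 (D + 1), (((2 * k).choose k : ℕ) : ℝ) / (4 : ℝ) ^ k *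
      |(fwdDiff (1 : ℕ))^[k] (fun j : ℕ => shellLaw M.2.partner univ H (2 * r + 1 + 6) (2 * j + 1) (x : ℤ)) 0| ≤
      Γ * q ^ k * shellLaw M.2.partner univ H (2 * r + 1 + 6) 1 (x : ℤ) + (4 / 3 : ℝ) ^ k * Real.exp (-((L - 2 * D) ^ 2 / (4 * N₀))) := by
    intro k hk
    have h := hR₀ k hk
    have h' := lqShape_dominate (κ' := 1) (κ := 1) (w := (4 / 3 : ℝ) ^ k) (by simpa only [one_mul] using h) hΓ₀0 hΓ₀ hq₀0 hq₀ hlaw0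
      zero_le_one le_rfl (by positivity) (hτ0 _) le_rfl
    simpa only [one_mul] using h'
  have hB₁ : ∀ k ∈ Ico 1 (D + 1), (((2 * k).choose k : ℕ) : ℝ) / (4 : ℝ) ^ k *
      |(fwdDiff (1 : ℕ))^[k] (fun j : ℕ => ∑ v ∈ reps M.2.partner (vAA M.2.partner univ H),
        shellLaw M.2.partner (univ \ {v, M.2.partner v}) H (2 * r + 3 + 2) (2 * j + 1) ((x : ℤ) - 2)) 0| ≤
      Γ * q ^ k * (∑ v ∈ reps M.2.partner (vAA M.2.partner univ H),
        shellLaw M.2.partner (univ \ {v, M.2.partner v}) H (2 * r + 3 + 2) 1 ((x : ℤ) - 2)) + (a : ℝ) * ((4 / 3 : ℝ) ^ k * Real.exp (-((L - 2 * D) ^ 2 / (4 * N₀)))) := by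
    intro k hk
    exact lqShape_dominate (hR₁ k hk) hΓ₁0 hΓ₁ hq₁0 hq₁ hG1_0 ha0 le_rfl (by positivity) (hτ0 _) hτ₁
  have hB₂ : ∀ k ∈ Ico 1 (D + 1), (((2 * k).choose k : ℕ) : ℝ) / (4 : ℝ) ^ k *
      |(fwdDiff (1 : ℕ))^[k] (fun j : ℕ => ∑ v ∈ reps M.2.partner (vAA M.2.partner univ H),
        ∑ w ∈ (reps M.2.partner (vAA M.2.partner univ H)).erase v,
          shellLaw M.2.partner (del2 M.2.partner univ v w) H (2 * r + 3) (2 * j + 1) ((x : ℤ) - 4)) 0| ≤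
      Γ * q ^ k * (∑ v ∈ reps M.2.partner (vAA M.2.partner univ H), ∑ w ∈ (reps M.2.partner (vAA M.2.partner univ H)).erase v,
        shellLaw M.2.partner (del2 M.2.partner univ v w) H (2 * r + 3) 1 ((x : ℤ) - 4)) + (a : ℝ) ^ 2 * ((4 / 3 : ℝ) ^ k * Real.exp (-((L - 2 * D) ^ 2 / (4 * N₀)))) := by
    intro k hk
    exact lqShape_dominate (hR₂ k hk) hΓ₂0 hΓ₂ hq₂0 hq₂ hG2_0 (Nat.cast_nonneg _) hκ₂ (by positivity) (hτ0 _) hτ₂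
  -- brick 139
  have hΓ1 : 1 ≤ Γ := le_trans (le_add_of_nonneg_right (by positivity)) hΓ₀
  have hq0 : 0 ≤ q := hq₀0.trans hq₀
  have hxε' : |(x : ℝ) - (2 * ((r : ℝ) + 3) + 1) * (2 * a + b) / (2 * N₀)| ≤ ε := by
    have e : (2 * ((r : ℝ) + 3) + 1) * (2 * a + b) / (2 * N₀) = (2 * (s : ℝ) + 1) * H.card / n := by
      rw [hrr, hHcard, hnr]
    rw [e]; exact hxε.le
  have hcentre' := hcentre
  rw [hcut0] at hcentre'
  have hVA' := hVA
  rw [← shellIn_univ, hcut0] at hVA'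
  have hLBl' := hLBl
  rw [hcut0] at hLBl'
  have h139 := sum_abs_fwdDiff_centredSecond_le_rel M H ha hb hd hN hn hβ (by linarith only [hβ1]) (by linarith only [hbβ, hD1r])
    (by linarith only [hdβ, hD1r]) (r := r) (by rw [hN0r, hN1r]; linarith only [hs, hrr, hsr, hs1r, hβ1, hD1r])
    (by
      have e : 8 * ((r : ℝ) + 2) = 8 * s - 8 := by rw [← hrr]; ring
      rw [e]; nlinarith only [hs', hβ.le, hD1r, hβ1])
    (by omega) (by omega) (D := D) hD1 (by omega) (by omega) (x := x) (by omega) hxε' h2Lx hLxN hLx1 hLx2 hwin hN4 hkV m hcentre'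
    (fun T t' y => (∑ U ∈ ((shellIn M.2.partner T t' 1).filter fun U => ((U ∩ H).card : ℤ) = y),
        (((((reps M.2.partner (vAA M.2.partner T H)).filter fun v => v ∈ U ∧ M.2.partner v ∈ U).card : ℕ) : ℝ) - m) ^ 2) / ((shellIn M.2.partner T t' 1).card : ℝ))
    (fun T t' y => (∑ U ∈ ((shellIn M.2.partner T t' 1).filter fun U => ((U ∩ H).card : ℤ) = y),
        (((((reps M.2.partner (vAA M.2.partner T H)).filter fun v => v ∈ U ∧ M.2.partner v ∈ U).card : ℕ) : ℝ) * (((((reps M.2.partner (vAA M.2.partner T H)).filter fun v => v ∈ U ∧ M.2.partner v ∈ U).card : ℕ) : ℝ) - 1))) / ((shellIn M.2.partner T t' 1).card : ℝ))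
    (fun T t' y => (∑ U ∈ ((shellIn M.2.partner T t' 1).filter fun U => ((U ∩ H).card : ℤ) = y),
        ((((reps M.2.partner (vAA M.2.partner T H)).filter fun v => v ∈ U ∧ M.2.partner v ∈ U).card : ℕ) : ℝ)) / ((shellIn M.2.partner T t' 1).card : ℝ))
    (fun _ _ _ => rfl) (fun _ _ _ => rfl) (fun _ _ _ => rfl) hE0 hFar0 hE hFar hΓ1 hq0 hq1 (Real.exp_nonneg _) hB₀ hB₁ hB₂ hV hLB
    hVA' hLBl'
  simp only [shellIn_univ, ← hcut0] at h139
  exact h139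

end Summit.PneNP.PneNP.Theorems.ChebyshevTracialDesignGammaDirectionSecondMomentSlot

end
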